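/-
Copyright (c) 2026 the pub-hodgecm-mathlib formalisation cell (harness21).  Prover seat hodgecm-mathlib-K2E5-p16 (g6), Track B «K2-LIT»,
#184♮ = hLiu418 = `stmt-HodgeConjecture-24832`; row `K2LiuArchIntertwiningLieEquivariance` (LEAD F0P6-plan (g13) 10:13:40Z ∕ (g14) BATCH #1;
K2Liu-p11 (g2) 10:47:31Z «defer (A) to K2E5-p16»), letter file (L-ii) for (A) `K2LiuArchIntertwiningLieDerivative`: the absolute-convergence MAJORANT
of the intertwining integral in the `hermOfReal` chart, and the continuity ∕ modulus of the scalar-type vector `f⁰_{s,k}` in the group variable.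
THEOREMS ONLY (no `def`, no `instance`, no notation, no named-fact hypothesis, no `sorry`).
-/
import Summits.HodgeConjecture.HodgeConjecture.Theorems.K2LiuArchIntertwiningScalarSection   -- ★ `det_hermTwo_add_I_smul`, tube frame, `hermOfReal` chart
import Summits.HodgeConjecture.HodgeConjecture.Theorems.K2LiuHermTwoDetPowerIntegrable      -- ★ Φ6b-1 `integrable_norm_det_add_I_smul_rpow_neg`
import Mathlib.MeasureTheory.Group.Integral
import Mathlib.Analysis.SpecialFunctions.Pow.Continuity
import Mathlib.Topology.Instances.Matrix
import HarnessLib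

/-!
# Crux `HLiu418`, A∞ organ: the majorant of `M_w` in the `hermOfReal` chart; continuity and modulus of `f⁰_{s,k}`

Cell `hodgecm-mathlib`, crux item hLiu418 = `stmt-HodgeConjecture-24832` (helper lane `--supports`, count-neutral).

The intertwining integral of record is `archIntertwining f g = ∫_{r : Fin 2 → Fin 2 → ℝ} f (J · transl (hermOfReal r) · g)` (★ (D∞)); its
integrand for `f = f⁰_{s,k}` has modulus `|det((hermOfReal r + Z)·d)|^{−(2σ+2)}` (`Z = g·i1 = U + iV`, `d = j(g, i1)`, `σ = re s`).  This file
supplies the three analytic letters the swap lemma (A) consumes: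
* §1 `continuous_denom ∕ continuous_num` — the automorphy matrices are continuous in the group variable; `continuousAt_archScalarSection` —
  `f⁰_{s,k}` is continuous at every `y` with `j(y, i1) ≠ 0` (in particular on `U(J)`);
* §2 `norm_archScalarSection_eq` — `‖f⁰_{s,k}(y)‖ = ‖j(y, i1)‖^{−(2·re s + l)}` (generic rank `l`);
* §3 `integrable_norm_det_hermOfReal_add_rpow_neg` — for `U` Hermitian, `V > 0` and `a > 3`, `r ↦ ‖det(hermOfReal r + U + iV)‖^{−a}` is
  integrable on `Fin 2 → Fin 2 → ℝ`: ★ Φ6b-1 (`hermTwo` chart, [Shimura1982, (1.26)]) moved to the `hermOfReal` chart by the Haar translation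
  `r ↦ r + r₀` (`hermOfReal r₀ = U`) and the linear change of chart ★ `exists_shuffle` ∕ ★ `exists_stretch` (`det = −8`).
References: [Shimura1982, §1 (1.26)]; [Shimura1997, §16.4].
HONEST LABEL: HC_CM is proved only modulo the 7 printed citations (2 remaining named inputs: hLiu418 = stmt-HodgeConjecture-24832,
h413 = stmt-HodgeConjecture-24833) until rung 0 closes; count-neutral helper, closes no socket.
-/

set_option autoImplicit false
set_option linter.dupNamespace false

noncomputable section

open Complex Matrix MeasureTheory
open scoped ComplexConjugate ComplexOrder

namespace Summit.HodgeConjecture.HodgeConjecture.Cruxes.HLiu418.K2LiuArchIntertwiningMajorant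

open Literature.NumberTheory.ModularForms.SiegelUpperHalfSpace (num denom num_def denom_def)
open Summit.HodgeConjecture.HodgeConjecture.Cruxes.HLiu418.K2LiuHermTwoGammaDefs
open Summit.HodgeConjecture.HodgeConjecture.Cruxes.HLiu418.K2LiuArchInducedTubeDefs
open Summit.HodgeConjecture.HodgeConjecture.Cruxes.HLiu418.K2LiuArchIntertwiningScalarValue (exists_shuffle exists_stretch hermOfReal_eq_hermTwo)
open Summit.HodgeConjecture.HodgeConjecture.Cruxes.HLiu418.K2LiuArchIntertwiningScalarSection (det_hermTwo_add_I_smul)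
open Summit.HodgeConjecture.HodgeConjecture.Cruxes.HLiu418.K2LiuHermTwoDetPowerIntegrable (det_sub_I_smul_eq_conj
  integrable_norm_det_add_I_smul_rpow_neg)

/-! ## §1  Continuity in the group variable -/

section Continuity

variable {l : Type*} [Fintype l] [DecidableEq l]

omit [DecidableEq l] in
/-- `M ↦ denom M Z = M₂₁ Z + M₂₂` is continuous. [folklore] -/
theorem continuous_denom (Z : Matrix l l ℂ) : Continuous fun M : Matrix (l ⊕ l) (l ⊕ l) ℂ => denom M Z := by
  have h21 : Continuous fun M : Matrix (l ⊕ l) (l ⊕ l) ℂ => M.toBlocks₂₁ := continuous_id.matrix_submatrix Sum.inr Sum.inl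
  have h22 : Continuous fun M : Matrix (l ⊕ l) (l ⊕ l) ℂ => M.toBlocks₂₂ := continuous_id.matrix_submatrix Sum.inr Sum.inr
  simp only [denom_def]
  exact (h21.matrix_mul continuous_const).add h22

omit [DecidableEq l] in
/-- `M ↦ num M Z = M₁₁ Z + M₁₂` is continuous. [folklore] -/
theorem continuous_num (Z : Matrix l l ℂ) : Continuous fun M : Matrix (l ⊕ l) (l ⊕ l) ℂ => num M Z := by
  have h11 : Continuous fun M : Matrix (l ⊕ l) (l ⊕ l) ℂ => M.toBlocks₁₁ := continuous_id.matrix_submatrix Sum.inl Sum.inl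
  have h12 : Continuous fun M : Matrix (l ⊕ l) (l ⊕ l) ℂ => M.toBlocks₁₂ := continuous_id.matrix_submatrix Sum.inl Sum.inr
  simp only [num_def]
  exact (h11.matrix_mul continuous_const).add h12

/-- `M ↦ j(M, i1) = det (denom M (i1))` is continuous. [folklore] -/
theorem continuous_det_denom : Continuous fun M : Matrix (l ⊕ l) (l ⊕ l) ℂ => (denom M (I • (1 : Matrix l l ℂ))).det :=
  (continuous_denom _).matrix_det

/-- The scalar kernel `δ ↦ δ^{−k} · ‖δ‖^m` is continuous at every `δ ≠ 0`. [folklore] -/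
theorem continuousAt_zpow_mul_norm_cpow (k : ℤ) (m : ℂ) {δ : ℂ} (hδ : δ ≠ 0) :
    ContinuousAt (fun z : ℂ => z ^ (-k) * (((‖z‖ : ℝ) : ℂ) ^ m)) δ := by
  have h1 : ContinuousAt (fun z : ℂ => z ^ (-k)) δ := continuousAt_zpow₀ δ (-k) (Or.inl hδ)
  have h2 : ContinuousAt (fun z : ℂ => ((‖z‖ : ℝ) : ℂ) ^ m) δ := by
    have hn : ContinuousAt (fun z : ℂ => ((‖z‖ : ℝ) : ℂ)) δ := (Complex.continuous_ofReal.comp continuous_norm).continuousAt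
    have hslit : ((‖δ‖ : ℝ) : ℂ) ∈ slitPlane := Complex.ofReal_mem_slitPlane.2 (norm_pos_iff.mpr hδ)
    exact ContinuousAt.comp (g := fun w : ℂ => w ^ m) (continuousAt_cpow_const hslit) hn
  exact h1.mul h2

/-- **`f⁰_{s,k}` is continuous at every `y` with `j(y, i1) ≠ 0`** (so on all of `U(J)` and on a neighbourhood of it). [Shimura1997, §16.4] -/
theorem continuousAt_archScalarSection (k : ℤ) (s : ℂ) {y : Matrix (l ⊕ l) (l ⊕ l) ℂ} (hy : (denom y (I • (1 : Matrix l l ℂ))).det ≠ 0) :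
    ContinuousAt (archScalarSection (l := l) k s) y := by
  have hf : (archScalarSection (l := l) k s) =
      (fun z : ℂ => z ^ (-k) * (((‖z‖ : ℝ) : ℂ) ^ ((k : ℂ) - 2 * s - (Fintype.card l : ℂ)))) ∘
        fun M : Matrix (l ⊕ l) (l ⊕ l) ℂ => (denom M (I • (1 : Matrix l l ℂ))).det := by
    funext M
    simp only [Function.comp_apply, archScalarSection_apply]
  rw [hf]
  exact ContinuousAt.comp (continuousAt_zpow_mul_norm_cpow k _ hy) continuous_det_denom.continuousAt

/-- Continuity of `f⁰_{s,k}` along a continuous map landing in `{j ≠ 0}`. [folklore] -/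
theorem continuous_archScalarSection_comp (k : ℤ) (s : ℂ) {X : Type*} [TopologicalSpace X] {φ : X → Matrix (l ⊕ l) (l ⊕ l) ℂ}
    (hφ : Continuous φ) (h : ∀ x, (denom (φ x) (I • (1 : Matrix l l ℂ))).det ≠ 0) :
    Continuous fun x => archScalarSection k s (φ x) :=
  continuous_iff_continuousAt.2 fun x => (continuousAt_archScalarSection k s (h x)).comp hφ.continuousAt

/-! ## §2  The modulus of `f⁰_{s,k}` -/

/-- The modulus of the scalar kernel: `‖δ^{−k} · ‖δ‖^m‖ = ‖δ‖^{re m − k}` for `δ ≠ 0`. [folklore] -/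
theorem norm_zpow_mul_norm_cpow (k : ℤ) (m : ℂ) {δ : ℂ} (hδ : δ ≠ 0) :
    ‖δ ^ (-k) * (((‖δ‖ : ℝ) : ℂ) ^ m)‖ = ‖δ‖ ^ (m.re - k) := by
  have hpos : 0 < ‖δ‖ := norm_pos_iff.mpr hδ
  rw [norm_mul, norm_zpow, Complex.norm_cpow_eq_rpow_re_of_pos hpos, ← Real.rpow_intCast, ← Real.rpow_add hpos]
  congr 1
  push_cast
  ring

/-- **THE MODULUS OF THE SCALAR-TYPE VECTOR**: `‖f⁰_{s,k}(y)‖ = ‖j(y, i1)‖^{−(2·re s + l)}` whenever `j(y, i1) ≠ 0` (the weight `k` drops out).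
[Shimura1997, §16.4] -/
theorem norm_archScalarSection_eq (k : ℤ) (s : ℂ) {y : Matrix (l ⊕ l) (l ⊕ l) ℂ} (hy : (denom y (I • (1 : Matrix l l ℂ))).det ≠ 0) :
    ‖archScalarSection k s y‖ = ‖(denom y (I • (1 : Matrix l l ℂ))).det‖ ^ (-(2 * s.re + (Fintype.card l : ℝ))) := by
  rw [archScalarSection_apply, norm_zpow_mul_norm_cpow k _ hy]
  congr 1
  simp only [Complex.sub_re, Complex.intCast_re, Complex.mul_re, Complex.re_ofNat, Complex.im_ofNat, Complex.natCast_re, zero_mul,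
    sub_zero]
  ring

/-- The `2 × 2` reading: `‖f⁰_{s,k}(y)‖ = ‖j(y, i1)‖^{−(2·re s + 2)}`. [Shimura1997, §16.4] -/
theorem norm_archScalarSection_eq_two (k : ℤ) (s : ℂ) {y : Matrix (Fin 2 ⊕ Fin 2) (Fin 2 ⊕ Fin 2) ℂ}
    (hy : (denom y (I • (1 : Matrix (Fin 2) (Fin 2) ℂ))).det ≠ 0) :
    ‖archScalarSection k s y‖ = ‖(denom y (I • (1 : Matrix (Fin 2) (Fin 2) ℂ))).det‖ ^ (-(2 * s.re + 2)) := by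
  rw [norm_archScalarSection_eq k s hy, Fintype.card_fin]
  norm_num

/-- The comparability step of the majorant: if `x₀ ≤ 4·x` with `0 < x₀` then `x^{−a} ≤ 4^a · x₀^{−a}` (`a ≥ 0`). [folklore] -/
theorem rpow_neg_le_of_le_four_mul {x x₀ a : ℝ} (hx₀ : 0 < x₀) (h : x₀ ≤ 4 * x) (ha : 0 ≤ a) :
    x ^ (-a) ≤ (4 : ℝ) ^ a * x₀ ^ (-a) := by
  have hx : 0 < x := by linarith
  have h1 : x₀ / 4 ≤ x := by linarith
  have h2 : x ^ (-a) ≤ (x₀ / 4) ^ (-a) := Real.rpow_le_rpow_of_nonpos (by positivity : 0 < x₀ / 4) h1 (by linarith)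
  rw [Real.div_rpow hx₀.le (by norm_num), Real.rpow_neg (by norm_num : (0 : ℝ) ≤ 4), div_eq_mul_inv, inv_inv, mul_comm] at h2
  exact h2

/-! ## §3  The majorant in the `hermOfReal` chart -/

/-- `|det(X + iV)| = |det(V + iX)|` for `V > 0`, `X = hermTwo c` (`X + iV = i(V − iX)`, `det(V − iX) = conj det(V + iX)`). [folklore] -/
theorem norm_det_hermTwo_add_I_smul {V : Matrix (Fin 2) (Fin 2) ℂ} (hV : V.PosDef) (c : ℝ × ℂ × ℝ) :
    ‖(hermTwo c + I • V).det‖ = ‖(V + I • hermTwo c).det‖ := by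
  rw [det_hermTwo_add_I_smul, norm_neg, det_sub_I_smul_eq_conj hV, Complex.norm_conj]

/-- Transfer of integrability from the `hermTwo` chart (`ℝ × ℂ × ℝ`) to the `hermOfReal` chart (`Fin 2 → Fin 2 → ℝ`): both are linear charts of
`Herm₂(ℂ)`, related by a measure-preserving shuffle and a linear stretch of determinant `−8`. [folklore] -/
theorem integrable_comp_hermOfReal {F : Matrix (Fin 2) (Fin 2) ℂ → ℝ} (hF : Integrable (fun c : ℝ × ℂ × ℝ => F (hermTwo c))) :
    Integrable (fun r : Fin 2 → Fin 2 → ℝ => F (hermOfReal r)) := by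
  obtain ⟨e₀, he₀, he₀r⟩ := exists_shuffle
  obtain ⟨T, hTdet, hT⟩ := exists_stretch
  have hdet : LinearMap.det T ≠ 0 := by
    rw [hTdet]
    norm_num
  haveI : (volume : Measure (ℝ × ℂ × ℝ)).IsAddHaarMeasure := by
    rw [show (volume : Measure (ℝ × ℂ × ℝ)) = (volume : Measure ℝ).prod ((volume : Measure ℂ).prod (volume : Measure ℝ)) from rfl]
    haveI : ((volume : Measure ℂ).prod (volume : Measure ℝ)).IsAddHaarMeasure := Measure.prod.instIsAddHaarMeasure _ _
    exact Measure.prod.instIsAddHaarMeasure _ _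
  -- `hermOfReal r = hermTwo (T (e₀ r))`
  have hcomp : ∀ r : Fin 2 → Fin 2 → ℝ, hermOfReal r = hermTwo (T (e₀ r)) := by
    intro r
    rw [hermOfReal_eq_hermTwo, he₀r, hT]
  -- integrability against `map T volume = |det T|⁻¹ • volume`
  let e : (ℝ × ℂ × ℝ) ≃L[ℝ] (ℝ × ℂ × ℝ) := (LinearMap.equivOfDetNeZero T hdet).toContinuousLinearEquiv
  have he : (e : (ℝ × ℂ × ℝ) → (ℝ × ℂ × ℝ)) = T := rfl
  have hemb : MeasurableEmbedding T := by
    rw [← he]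
    exact e.toHomeomorph.toMeasurableEquiv.measurableEmbedding
  have hT' : Integrable (fun c : ℝ × ℂ × ℝ => F (hermTwo (T c))) := by
    have h1 : Integrable (fun c : ℝ × ℂ × ℝ => F (hermTwo c)) (Measure.map T volume) := by
      rw [Measure.map_linearMap_addHaar_eq_smul_addHaar _ hdet]
      exact hF.smul_measure ENNReal.ofReal_ne_top
    exact (hemb.integrable_map_iff.1 h1)
  have h2 : Integrable ((fun c : ℝ × ℂ × ℝ => F (hermTwo (T c))) ∘ e₀) :=
    (he₀.integrable_comp_emb e₀.measurableEmbedding).2 hT'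
  refine h2.congr (Filter.Eventually.of_forall fun r => ?_)
  simp only [Function.comp_apply, hcomp]

/-- **THE MAJORANT OF `M_w` IN THE `hermOfReal` CHART**: for `U` Hermitian, `V` positive definite (`2 × 2`) and `a > 3`,
`r ↦ ‖det(hermOfReal r + U + iV)‖^{−a}` is integrable on `Fin 2 → Fin 2 → ℝ` (Lebesgue).  With `a = 2σ + 2` this is the absolute-convergence
majorant of `M_w(s) f⁰_{s,k}` at the group element `g` with `g·i1 = U + iV` — integrable iff `σ > ½`. [Shimura1982, (1.26), Case II, m = κ = 2] -/
theorem integrable_norm_det_hermOfReal_add_rpow_neg {U V : Matrix (Fin 2) (Fin 2) ℂ} (hU : U.IsHermitian) (hV : V.PosDef) {a : ℝ}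
    (ha : 3 < a) :
    Integrable (fun r : Fin 2 → Fin 2 → ℝ => ‖(hermOfReal r + (U + I • V)).det‖ ^ (-a)) := by
  -- (1) the majorant without the real translate, in the `hermOfReal` chart
  have h0 : Integrable (fun r : Fin 2 → Fin 2 → ℝ => ‖(hermOfReal r + I • V).det‖ ^ (-a)) := by
    have h := integrable_comp_hermOfReal (F := fun X => ‖(X + I • V).det‖ ^ (-a)) (by
      have h1 := integrable_norm_det_add_I_smul_rpow_neg hV ha
      refine h1.congr (Filter.Eventually.of_forall fun c => ?_)
      simp only [norm_det_hermTwo_add_I_smul hV c])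
    exact h
  -- (2) translate by `r₀` with `hermOfReal r₀ = U`
  obtain ⟨r₀, hr₀⟩ := exists_hermOfReal_eq hU.eq
  have h1 := h0.comp_add_right r₀
  refine h1.congr (Filter.Eventually.of_forall fun r => ?_)
  simp only [hermOfReal_add, hr₀]
  rw [add_assoc]

end Continuity

end Summit.HodgeConjecture.HodgeConjecture.Cruxes.HLiu418.K2LiuArchIntertwiningMajorant

end
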